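import Summits.QuantumFields.YangMills.Theorems.ColdStartUniversalityColdStartSolutionsExist
import Summits.QuantumFields.YangMills.Theorems.ColdStartUniversalityLatticeLangevinUniqueness
import HarnessLib

/-!
# Route `ColdStartUniversality` (rung input (E) of crux K_A1, stmt-QuantumFields-24809): GLOBAL
# WELL-POSEDNESS of the SU(2) lattice Langevin dynamics from every start — SZZ Lemma 3.2 for
# `r = fundamentalLatticeRep 2`, `d = 3`, i.e. the named fact `LatticeLangevinWellPosed (fundamentalLatticeRep 2) 3 L β`

Helper file (seat `ym-line-csu-p1`).  `latticeLangevinWellPosed_su2 : LatticeLangevinWellPosed (fundamentalLatticeRep 2) 3 L β`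
for every torus size `L` and coupling `β`: on every probability space (in `Type`) carrying a flat Brownian
motion `W` and for every initial configuration `U₀ ∈ SU(2)^E` there is a solution of the Shen–Zhu–Zhu system
through the fundamental representation, adapted to the raw natural filtration of `W`, with `U 0 = U₀`, and
any two such solutions are indistinguishable (Shen–Zhu–Zhu arXiv:2204.12737 §3 Lemma 3.2 = SSZ Lemma 3.2).

* `solution_from_start` — strong existence from an arbitrary deterministic start on an arbitrary space: the
  cold-start construction of `coldStart_solution` (seat g2: tame tangent modification of the SZZ system,
  vector Picard iteration in quaternion coordinates `ambient_exists_of_tame`, conservation of `‖X_e‖_F² = 2`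
  by `tangentSumSq`, retraction onto `SU(2)`) run from `Q₀ = ρ ∘ U₀` instead of `Q₀ ≡ 1`;
* uniqueness is `latticeLangevin_pathwise_unique` (`…LatticeLangevinUniqueness`).

The measurability lemmas `measurable_su2_of_entries`, `measurableSet_mem_su2` are reused from
`…ColdStartSolutionsExist` (dedup lint; this puts the file in the route's Theses cone — accepted, it is a
route helper).  No definition, no sorry.  RECORD-rung R3 plumbing: what the rung input (E) and every
«for all solutions» clause of the route's cruxes presuppose; nothing here bears on the mass gap. -/

set_option autoImplicit false

noncomputable section

namespace Summit.QuantumFields.YangMills.Theorems.ColdStartUniversality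

open MeasureTheory ProbabilityTheory Filter Topology
open scoped NNReal ENNReal BigOperators
open Literature.Probability.Process Literature.MathematicalPhysics.QuantumFieldTheory
open Literature.MathematicalPhysics.QuantumLattice (fundamentalRep fundamentalLatticeRep)

/-- **Strong existence from every deterministic start, on every space** (SZZ Lemma 3.2, existence clause,
`SU(2)`, `d = 3`): for a flat Brownian motion `W` on a probability space `(Ω, P)` and `U₀ ∈ SU(2)^E` there
is a solution `U` of `latticeLangevinDynamics (fundamentalLatticeRep 2) β` through the fundamental
representation, adapted to the raw natural filtration of `W`, with `U 0 = U₀`.  (The construction of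
`coldStart_solution`, started at `ρ ∘ U₀`.) [cite: ShenZhuZhu2022, §3 Lemma 3.2 (global well-posedness; p. 13)] -/
theorem solution_from_start {Ω : Type} [MeasurableSpace Ω] {P : Measure Ω} [IsProbabilityMeasure P]
    {L : ℕ} [NeZero L] {W : ℝ≥0 → Ω → (Edge 3 L × NoiseIdx 2 → ℝ)} (hW : IsFlatBrownian W P) (β : ℝ)
    (U₀ : GaugeConfig 3 L (Matrix.specialUnitaryGroup (Fin 2) ℂ)) :
    ∃ U : ℝ≥0 → Ω → GaugeConfig 3 L (Matrix.specialUnitaryGroup (Fin 2) ℂ),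
      (∀ ω, U 0 ω = U₀) ∧
      (latticeLangevinDynamics (fundamentalLatticeRep 2) β).IsSolution (fundamentalRep (Fin 2))
        hW.natFiltration P W U := by
  classical
  obtain ⟨S, ⟨⟨K, hK⟩, hV⟩, hTan, hAgree⟩ := exists_truncatedCoefficients L β
  -- the start in matrix coordinates
  set Q₀ : MatrixConfig 3 L 2 := matrixConfig (fundamentalRep (Fin 2)) U₀ with hQ₀def
  have hQ₀V : ∀ e, Q₀ e ∈ Submodule.span ℝ (Set.range (fundamentalRep (Fin 2))) := fun e =>
    rho_mem_spanRange (fundamentalLatticeRep 2) (U₀ e)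
  have hQ₀sph : ∀ e, hsForm 2 (Q₀ e) (Q₀ e) = 2 := fun e => hsForm_self_fundamentalRep (U₀ e)
  -- the ambient solution (vector Picard in quaternion coordinates), `V`-valued
  obtain ⟨X, hX, hXV⟩ := ambient_exists_of_tame hW S (fun Q Q' e => (hK Q Q' e).1)
    (fun Q Q' e n => (hK Q Q' e).2 n) hV Q₀ hQ₀V
  obtain ⟨hXad, hXp, hXc, hX2, hX0, J, hJ, hXeq⟩ := hX
  -- the Frobenius norms are preserved (tangency)
  have hsph : ∀ᵐ ω ∂P, ∀ (t : ℝ≥0) (e : Edge 3 L), hsForm 2 (X t ω e) (X t ω e) = hsForm 2 (Q₀ e) (Q₀ e) :=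
    frobenius_preserved_of_tangent' tangentSumSq hW S (fun Q Q' e => (hK Q Q' e).1)
      (fun Q Q' e n => (hK Q Q' e).2 n) (fun Q e => (hTan Q e).1) (fun Q e n => (hTan Q e).2 n) Q₀ hXp hXc
      hX2 hJ hXeq
  -- a.s. the solution is SU(2)-valued at all times
  have hmem : ∀ᵐ ω ∂P, ∀ (t : ℝ≥0) (e : Edge 3 L), X t ω e ∈ Matrix.specialUnitaryGroup (Fin 2) ℂ := by
    filter_upwards [hsph] with ω hω t e
    obtain ⟨g, hg⟩ := mem_range_fundamentalRep_of_mem_span (hXV t ω e) (by rw [hω t e, hQ₀sph e])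
    rw [← hg]
    exact g.2
  -- the measurable retraction onto `SU(2)` (identity on `SU(2)`, `1` elsewhere)
  set toSU2 : Matrix (Fin 2) (Fin 2) ℂ → Matrix.specialUnitaryGroup (Fin 2) ℂ :=
    fun Q => if h : Q ∈ Matrix.specialUnitaryGroup (Fin 2) ℂ then ⟨Q, h⟩ else 1 with htoSU2
  have coe_toSU2_of_mem : ∀ {Q : Matrix (Fin 2) (Fin 2) ℂ}, Q ∈ Matrix.specialUnitaryGroup (Fin 2) ℂ →
      (toSU2 Q : Matrix (Fin 2) (Fin 2) ℂ) = Q := fun {Q} h => by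
    simp only [htoSU2, dif_pos h]
  have toSU2_coe : ∀ g : Matrix.specialUnitaryGroup (Fin 2) ℂ, toSU2 (g : Matrix (Fin 2) (Fin 2) ℂ) = g :=
    fun g => Subtype.ext (coe_toSU2_of_mem g.2)
  have coe_toSU2 : ∀ Q : Matrix (Fin 2) (Fin 2) ℂ, (toSU2 Q : Matrix (Fin 2) (Fin 2) ℂ) =
      if Q ∈ Matrix.specialUnitaryGroup (Fin 2) ℂ then Q else 1 := fun Q => by
    simp only [htoSU2]
    split_ifs <;> rfl
  have measurable_toSU2_comp : ∀ {mα : MeasurableSpace Ω} {f : Ω → Matrix (Fin 2) (Fin 2) ℂ},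
      Measurable[mα] (fun a => (fun i j => f a i j : Fin 2 → Fin 2 → ℂ)) →
      Measurable[mα] fun a => toSU2 (f a) := by
    intro mα f h
    refine measurable_su2_of_entries ?_
    have hfun : (fun a => (fun i j => (toSU2 (f a) : Matrix (Fin 2) (Fin 2) ℂ) i j : Fin 2 → Fin 2 → ℂ)) =
        fun a => if f a ∈ Matrix.specialUnitaryGroup (Fin 2) ℂ then (fun i j => f a i j : Fin 2 → Fin 2 → ℂ)
          else fun i j => (1 : Matrix (Fin 2) (Fin 2) ℂ) i j := by
      funext a
      rw [coe_toSU2]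
      split_ifs <;> rfl
    rw [hfun]
    exact Measurable.ite (measurableSet_mem_su2 h) h measurable_const
  -- the process `U`
  refine ⟨fun t ω e => toSU2 (X t ω e), fun ω => ?_, ?_⟩
  · funext e
    show toSU2 (X 0 ω e) = U₀ e
    rw [hX0 ω]
    exact toSU2_coe (U₀ e)
  have hcoe : ∀ᵐ ω ∂P, ∀ (t : ℝ≥0) (e : Edge 3 L), (fundamentalRep (Fin 2)) (toSU2 (X t ω e)) = X t ω e := by
    filter_upwards [hmem] with ω hω t e
    exact coe_toSU2_of_mem (hω t e)
  refine ⟨fun t => ?_, ?_, ⟨J, fun e n i j => ?_, ?_⟩⟩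
  · -- adapted
    letI : MeasurableSpace Ω := hW.natFiltration t
    exact measurable_pi_lambda _ fun e =>
      measurable_toSU2_comp ((measurable_pi_apply e).comp (hXad t))
  · -- a.s. continuous paths
    filter_upwards [hXc, hmem] with ω hωc hωm
    refine continuous_pi fun e => ?_
    have hval : Continuous fun t => ((toSU2 (X t ω e) : Matrix.specialUnitaryGroup (Fin 2) ℂ) :
        Matrix (Fin 2) (Fin 2) ℂ) := by
      have : (fun t => ((toSU2 (X t ω e) : Matrix.specialUnitaryGroup (Fin 2) ℂ) :
          Matrix (Fin 2) (Fin 2) ℂ)) = fun t => X t ω e := funext fun t => coe_toSU2_of_mem (hωm t e)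
      rw [this]
      exact (continuous_apply e).comp hωc
    exact Topology.IsInducing.subtypeVal.continuous_iff.2 hval
  · -- the Itô integrals: integrands agree a.s. with those of `X`
    refine (hJ e n i j).imp (fun h => h.congr_integrand_ae ?_) (fun h => h.congr_integrand_ae ?_) <;>
    · filter_upwards [hcoe] with ω hω t
      have hcfg : matrixConfig (fundamentalRep (Fin 2)) (fun e' => toSU2 (X t ω e')) = X t ω :=
        funext fun e' => hω t e'
      have h2 := (hAgree (fun e' => toSU2 (X t ω e')) e).2 n
      rw [hcfg] at h2
      simp only [h2]
  · -- the integral equations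
    filter_upwards [hXeq, hcoe] with ω hω hωc t e i j
    have hcfg : ∀ s : ℝ≥0, matrixConfig (fundamentalRep (Fin 2)) (fun e' => toSU2 (X s ω e')) = X s ω :=
      fun s => funext fun e' => hωc s e'
    have hdrift : ∀ s : ℝ≥0, (latticeLangevinDynamics (fundamentalLatticeRep 2) β).drift
        (matrixConfig (fundamentalRep (Fin 2)) (fun e' => toSU2 (X s ω e'))) e i j = S.drift (X s ω) e i j := by
      intro s
      have h1 := (hAgree (fun e' => toSU2 (X s ω e')) e).1
      rw [hcfg] at h1
      exact (congrFun (congrFun h1 i) j).symm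
    have hlhs : (fundamentalRep (Fin 2)) (toSU2 (X t ω e)) i j = X t ω e i j :=
      congrFun (congrFun (hωc t e) i) j
    have h0 : (fundamentalRep (Fin 2)) (toSU2 (X 0 ω e)) i j = Q₀ e i j := by
      rw [congrFun (congrFun (hωc 0 e) i) j, hX0 ω]
    have hint : (∫ s in (0 : ℝ)..t, (latticeLangevinDynamics (fundamentalLatticeRep 2) β).drift
          (matrixConfig (fundamentalRep (Fin 2)) (fun e' => toSU2 (X s.toNNReal ω e'))) e i j) =
        ∫ s in (0 : ℝ)..t, S.drift (X s.toNNReal ω) e i j :=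
      intervalIntegral.integral_congr fun s _ => hdrift s.toNNReal
    calc (fundamentalRep (Fin 2)) (toSU2 (X t ω e)) i j = X t ω e i j := hlhs
      _ = Q₀ e i j + (∫ s in (0 : ℝ)..t, S.drift (X s.toNNReal ω) e i j) + ∑ n, J e n i j t ω :=
          hω t e i j
      _ = (fundamentalRep (Fin 2)) (toSU2 (X 0 ω e)) i j +
            (∫ s in (0 : ℝ)..t, (latticeLangevinDynamics (fundamentalLatticeRep 2) β).drift
              (matrixConfig (fundamentalRep (Fin 2)) (fun e' => toSU2 (X s.toNNReal ω e'))) e i j) +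
            ∑ n, J e n i j t ω := by rw [h0, hint]

/-- **SZZ Lemma 3.2 for `SU(2)` in its fundamental representation on `(ℤ/L)³`: the named fact
`LatticeLangevinWellPosed (fundamentalLatticeRep 2) 3 L β` HOLDS** — global strong existence from every
start on every probability space carrying a flat Brownian motion (`solution_from_start`) and pathwise
uniqueness (`latticeLangevin_pathwise_unique`). [cite: ShenZhuZhu2022, §3 Lemma 3.2 (global well-posedness; p. 13)] -/
theorem latticeLangevinWellPosed_su2 (L : ℕ) [NeZero L] (β : ℝ) :
    LatticeLangevinWellPosed (fundamentalLatticeRep 2) 3 L β := by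
  intro _hcl Ω _ P _ W hW U₀
  obtain ⟨U, hU0, hsol⟩ := solution_from_start hW β U₀
  exact ⟨U, hU0, hsol, fun U' hU'0 hsol' => latticeLangevin_pathwise_unique hW β U₀ hU'0 hU0 hsol' hsol⟩

end Summit.QuantumFields.YangMills.Theorems.ColdStartUniversality

end
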